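import Summits.BirchSwinnertonDyer.Rank1Residual.X6.RankZeroCertificateSchema
import Summits.BirchSwinnertonDyer.Rank1Residual.Supersingular.X678DescentRecords
import Summits.BirchSwinnertonDyer.Rank1Residual.Supersingular.DescentLowerBoundRecords
import Summits.BirchSwinnertonDyer.Rank1Residual.Supersingular.DescentLowerBoundRecordsX6A
import Summits.BirchSwinnertonDyer.Rank1Residual.Supersingular.DescentLowerBoundRecordsX6B
import Summits.BirchSwinnertonDyer.Rank1Residual.Supersingular.DescentLowerBoundRecordsG24
import Summits.BirchSwinnertonDyer.Rank1Residual.Supersingular.DescentLowerBoundRecordsG29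
import Summits.BirchSwinnertonDyer.Rank1Residual.Supersingular.X6KuriharaRecords
import Summits.BirchSwinnertonDyer.Rank1Residual.Supersingular.X6KuriharaRecordsBW
import Summits.BirchSwinnertonDyer.Rank1Residual.Supersingular.DescentLowerBound
import Summits.BirchSwinnertonDyer.Rank1Residual.Supersingular.X6KuriharaRoute
import Summits.BirchSwinnertonDyer.Rank1Residual.SecondDescent.NonemptyCasselsTateFree
import Summits.BirchSwinnertonDyer.Rank1Residual.SecondDescent.NonemptyRecordsCardFree01
import Summits.BirchSwinnertonDyer.Rank1Residual.SecondDescent.NonemptyRecordsThree02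
import Summits.BirchSwinnertonDyer.Rank1Residual.Supersingular.KimKuriharaRecordsSupersingularC
import Summits.BirchSwinnertonDyer.Rank1Residual.Supersingular.X67KimTamDefectRecordsRanCert
import Summits.BirchSwinnertonDyer.Rank1Residual.Supersingular.X6KimTamDefectRecords
import Summits.BirchSwinnertonDyer.Rank1Residual.Supersingular.X6KimTamDefectRecordsB
import Summits.BirchSwinnertonDyer.Rank1Residual.Supersingular.X6KimTamDefectRecordsC
import Summits.BirchSwinnertonDyer.Rank1Residual.Supersingular.X6KimTamDefectRecordsLValues
import Summits.BirchSwinnertonDyer.Rank1Residual.Supersingular.X6KuriharaKP3OfferRecords01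
import Summits.BirchSwinnertonDyer.Rank1Residual.Supersingular.X6KuriharaKP3OfferRecords02
import Summits.BirchSwinnertonDyer.Rank1Residual.Supersingular.X6KuriharaKP3OfferRecords03
import Summits.BirchSwinnertonDyer.Rank1Residual.Supersingular.X6KuriharaOfferRecords01
import Summits.BirchSwinnertonDyer.Rank1Residual.Supersingular.X6KuriharaOfferRecords02
import Summits.BirchSwinnertonDyer.Rank1Residual.Supersingular.X6KuriharaOfferRecords03
import Summits.BirchSwinnertonDyer.Rank1Residual.Supersingular.X6KuriharaOfferRecords04
import Summits.BirchSwinnertonDyer.Rank1Residual.Supersingular.X6KuriharaOfferRecords05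
import Summits.BirchSwinnertonDyer.Rank1Residual.Supersingular.X6KuriharaOfferRecords06
import Summits.BirchSwinnertonDyer.Rank1Residual.Supersingular.X6KuriharaOfferRecords07
import Summits.BirchSwinnertonDyer.Rank1Residual.Supersingular.X6KuriharaOfferRecords08
import Summits.BirchSwinnertonDyer.Rank1Residual.Supersingular.X6KuriharaOfferRecords09
import Summits.BirchSwinnertonDyer.Rank1Residual.Supersingular.X6KuriharaOfferRecords10
import Summits.BirchSwinnertonDyer.Rank1Residual.Supersingular.X6KuriharaOfferRecords11
import Summits.BirchSwinnertonDyer.Rank1Residual.Supersingular.X6KuriharaOfferRecordsCyc01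
import Summits.BirchSwinnertonDyer.Rank1Residual.Supersingular.X6KuriharaOfferRecordsCyc02
import Summits.BirchSwinnertonDyer.Rank1Residual.Supersingular.X6KuriharaOfferRecordsCyc03
import Summits.BirchSwinnertonDyer.Rank1Residual.Supersingular.X6Visibility5Records01
import Summits.BirchSwinnertonDyer.Rank1Residual.Supersingular.X6VisibilitySevenRecords01
import Summits.BirchSwinnertonDyer.Rank1Residual.Supersingular.X6VisibilityTamDefectRecords
import Summits.BirchSwinnertonDyer.Rank1Residual.Supersingular.X6VisibilityTamDefectRecordsB
import Summits.BirchSwinnertonDyer.Rank1Residual.Supersingular.X6VisibilityWitnessFiveRecords001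
import Summits.BirchSwinnertonDyer.Rank1Residual.Supersingular.X6VisibilityWitnessFiveRecords002
import Summits.BirchSwinnertonDyer.Rank1Residual.Supersingular.X6VisibilityWitnessFiveRecords003
import Summits.BirchSwinnertonDyer.Rank1Residual.Supersingular.X6VisibilityWitnessFiveRecords004
import Summits.BirchSwinnertonDyer.Rank1Residual.Supersingular.X6VisibilityWitnessFiveRecords005
import Summits.BirchSwinnertonDyer.Rank1Residual.Supersingular.X6VisibilityWitnessFiveRecords006
import Summits.BirchSwinnertonDyer.Rank1Residual.Supersingular.X6VisibilityWitnessFiveRecords007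
import Summits.BirchSwinnertonDyer.Rank1Residual.Supersingular.X6VisibilityWitnessFiveRecords008
import Summits.BirchSwinnertonDyer.Rank1Residual.Supersingular.X6VisibilityWitnessFiveRecords009
import Summits.BirchSwinnertonDyer.Rank1Residual.Supersingular.X6VisibilityWitnessRecords01
import HarnessLib

/-!
# Class X6 ∧ analytic rank `0` — COVERAGE SCHEMA: the per-pair roads of record of the 734 residue records, joined in the kernel

Cell `bsd-print-x6` (D-0131 (2) print tier, key `x6`; HOME `run/shared/lean/pub/bsd-print-x6/`), typer seat ty3 (gen 2; PLAN v2 §ty3: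
«coverage display — which of the 734 records has a road input of record — as ONE kernel list»). The 734 records are
`PrintCert.allRecords` (`RankZeroCertificateDisplay.lean`: every (Cremona class, prime) of the bsdN sweep S-b residue of the leaf
`ClassX6 W p ∧ W.analyticRank = 0`, `N < 5·10⁵`). A ROAD OF RECORD for a record is a PER-PAIR object already in the tree, in one
of two shapes: (i) a two-engine certificate DATA ROW of a `Checked`/`Certified` data theorem whose generic consumer is a tree
theorem taking published inputs by name (`Supersingular.X6.bsdp_rankZero_of_casselsTate_of_selmerGroup_ne_bot` for the `3`-descent
rows, `Supersingular.X6.bsdp_of_kim_rankZero_of_kuriharaNumber_ne_zero` for the Kurihara rows), or (ii) a per-pair THEOREM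
`… : BSDp W p` for the record's literal minimal model. This file is the schema: the `Road` tags, the data sources `Src` (the row
lists are EXTRACTED from the tree's data theorems — `descRowsOf h` returns the implicit list index of `h : Checked rs` — never
re-typed), the entry type `Cover` (canonical road + declaration as a RESOLVED name literal + data pointer + secondary roads), the
Boolean recheck `covers` (label, prime, road discipline by `(p, ord_p #Ш_an)`, and for data roads: the pointed row carries the
record's label, a-invariants and `#Ш_an` resp. `p`), and its unpacking lemmas. Parts: `RankZeroCertificateCoverage3A/3B/5.lean`
(entries, `decide`); summary `RankZeroCertificateCoverage.lean` (the 734-list `coverage`, counts, corollaries, road table).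

HONEST FRAMING: this is a DISPLAY (bookkeeping in the kernel). It books nothing, moves no PARTITION cell, proves no class
theorem and asserts nothing about any curve beyond (a) what the cited tree files already state and (b) the JOIN itself. Every
per-pair theorem it names is CONDITIONAL on the binders printed in that theorem's own signature (named published facts by
name + the pair's certificate / claim lines; the `kp3OfferOPEN` road is conditional on an announced, unrefereed result and is
listed as a secondary road only); every data row it points to is a two-engine computation rechecked for SHAPE in its own file.
The class-wide statement (route PrintX6 cruxes `EisensteinHalfFiveLe` / `EisensteinHalfAtThree`) is untouched.

References: Cremona's tables [Cremona2006]; Schaefer–Stoll 2004 / Creutz 2014 (descents) [Creutz2014]; C.-H. Kim, Amer. J. Math. (2026)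
[Kim2022StructureSelmer]; Wuthrich 2014 Prop. 21 [Wuthrich2014]; Silverman *AEC* X.4 [SilvermanAEC2009].
-/

set_option autoImplicit false

noncomputable section

namespace Summit.BirchSwinnertonDyer.Rank1Residual.X6.PrintCert

open Summit.BirchSwinnertonDyer.Rank1Residual.Supersingular
open Literature.NumberTheory.EllipticCurves (KuriharaCertificates.Record KuriharaCertificates.Certified)

/-- The per-pair roads found in the tree for residue records (module docstring of `RankZeroCertificateCoverage.lean` has the
table: modules, binders, consumers). The first eight occur as CANONICAL roads; the last three only as secondary roads. [folklore] -/
inductive Road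
  /-- two-engine EXACT `3`-descent row `dim_𝔽₃ Sel^(3) = 2` (`X678DescentRecords`), `p = 3`, `ord₃ #Ш_an = 2` -/
  | desc3Exact
  /-- two-engine LOWER-BOUND `3`-descent row `dim_𝔽₃ Sel^(3) ≥ 2` (`DescentLowerBoundRecords*`), `p = 3`, `ord₃ #Ш_an = 2` -/
  | desc3LowerBound
  /-- per-pair theorem from a second `3`-descent `NONEMPTY × 2` record, Cassels–Tate-free (`SecondDescent.NonemptyCasselsTateFree`), `ord₃ #Ш_an = 4` -/
  | secondDescent
  /-- per-pair theorem `BSD(E,p)` from Kurihara numbers, C.-H. Kim 2026 Thm. 1.9 (6) by name (`X6KuriharaOfferRecords*`), `p ≥ 5` -/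
  | kuriharaOffer
  /-- two-engine Kurihara-number DATA row (`X6KuriharaRecords*`, schema `KuriharaCertificates`), consumer `X6.bsdp_of_kim_rankZero_of_kuriharaNumber_ne_zero` -/
  | kuriharaCert
  /-- per-pair theorem from Kurihara numbers on a named model (`KimKuriharaRecordsSupersingularC`) -/
  | kimKurihara
  /-- per-pair theorem, Kim's Tamagawa-defect form + Perrin-Riou Prop. 4.8 by name (`X6KimTamDefectRecords*`), `p ∣ ∏ c_ℓ` -/
  | kimTamDefect
  /-- per-pair theorem by visibility of `Ш[p]` in a rank-`2` congruent curve + Cassels–Tate (`X6VisibilityTamDefectRecords*`) -/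
  | visibility
  /-- SECONDARY only: per-pair `BSD(E,3)` CONDITIONAL on the announced Kim 2025 Thm. 1.1 (`_OPEN` binder; `X6KuriharaKP3OfferRecords*`) -/
  | kp3OfferOPEN
  /-- SECONDARY only: the Cassels–Tate-using variants of the second-descent theorems (`NonemptyRecordsThree*`, `…CardFree*`) -/
  | secondDescentCT
  /-- SECONDARY only: visibility-witness theorems on pairs whose canonical road is a Kurihara offer (`X6VisibilityWitness*`, `X6VisibilitySevenRecords01`) -/
  | visibilityWitness
  deriving DecidableEq

/-- Data roads (the entry carries a pointer into a tree row list). [folklore] -/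
def Road.isDesc3 : Road → Bool
  | .desc3Exact | .desc3LowerBound => true
  | _ => false

/-- The canonical roads admissible at `p ≥ 5`. [folklore] -/
def Road.atFive : Road → Bool
  | .kuriharaOffer | .kuriharaCert | .kimKurihara | .kimTamDefect | .visibility => true
  | _ => false

/-- A join key: (Cremona label, a-invariants of the minimal model, `#Ш_an` for descent rows resp. `p` for Kurihara rows). [folklore] -/
abbrev Key := String × List ℤ × ℕ

/-- The row list of a `Checked` exact-`3`-descent data theorem — its implicit index, i.e. THE TREE'S DATA, not a copy. [folklore] -/
def descRowsOf {rs : List DescentRecords.DescRow} (_h : DescentRecords.Checked rs) : List DescentRecords.DescRow := rs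

/-- The row list of a `Checked` lower-bound-`3`-descent data theorem. [folklore] -/
def lbRowsOf {rs : List DescentLowerBoundRecords.Row} (_h : DescentLowerBoundRecords.Checked rs) :
    List DescentLowerBoundRecords.Row := rs

/-- The row list of a `CheckedS` lower-bound-`3`-descent data theorem (engines with prime sets `S₂ ⊆ S₁`). [folklore] -/
def lbRowsOfS {rs : List DescentLowerBoundRecords.Row} (_h : DescentLowerBoundRecords.CheckedS rs) :
    List DescentLowerBoundRecords.Row := rs

/-- The row list of a `Certified` Kurihara-number data theorem. [folklore] -/
def kRowsOf {rs : List KuriharaCertificates.Record} (_h : KuriharaCertificates.Certified rs) : List KuriharaCertificates.Record := rs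

/-- The data sources: eight `3`-descent row lists and the eight Kurihara data theorems of the records whose canonical road is a
data row. [folklore] -/
inductive Src
  | exact | lbSample | lbA | lbB | g24 | g24S | g29 | g29S | k11998a1 | k20962b1 | k43314b1 | k45298c1 | k46774a1 | k12927e1 | k27466a1 | k44115c1
  deriving DecidableEq

/-- `3`-descent sources. [folklore] -/
def Src.isDesc3 : Src → Bool
  | .exact | .lbSample | .lbA | .lbB | .g24 | .g24S | .g29 | .g29S => true
  | _ => false

/-- The exact-descent source. [folklore] -/
def Src.isExact : Src → Bool
  | .exact => true
  | _ => false

set_option maxRecDepth 200000 in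
/-- The keys of a source, READ OFF THE TREE THEOREMS: `(label, ainvs, #Ш_an)` of each `3`-descent row, `(label, ainvs, p)` of each
Kurihara row. [folklore] -/
def Src.rows : Src → List Key
  | .exact => (descRowsOf DescentRecords.checked_x6_rankZero_sha9_desc3).map fun r => (r.label, r.ainvs, r.shaAn)
  | .lbSample => (lbRowsOf DescentLowerBoundRecords.checked_X6_sample).map fun r => (r.label, r.ainvs, r.shaAn)
  | .lbA => (lbRowsOf DescentLowerBoundRecords.checked_X6_beyond_partA).map fun r => (r.label, r.ainvs, r.shaAn)
  | .lbB => (lbRowsOf DescentLowerBoundRecords.checked_X6_beyond_partB).map fun r => (r.label, r.ainvs, r.shaAn)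
  | .g24 => (lbRowsOf DescentLowerBoundRecords.checked_beyond_addendum_g24).map fun r => (r.label, r.ainvs, r.shaAn)
  | .g24S => (lbRowsOfS DescentLowerBoundRecords.checkedS_addendum_g24).map fun r => (r.label, r.ainvs, r.shaAn)
  | .g29 => (lbRowsOf DescentLowerBoundRecords.checked_beyond_addendum_g29).map fun r => (r.label, r.ainvs, r.shaAn)
  | .g29S => (lbRowsOfS DescentLowerBoundRecords.checkedS_beyond_addendum_g29).map fun r => (r.label, r.ainvs, r.shaAn)
  | .k11998a1 => (kRowsOf KuriharaRecords.cert_X6_11998a1_p5).map fun r => (r.label, r.ainvs, r.p)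
  | .k20962b1 => (kRowsOf KuriharaRecords.cert_X6_20962b1_p5).map fun r => (r.label, r.ainvs, r.p)
  | .k43314b1 => (kRowsOf KuriharaRecords.cert_X6_43314b1_p5).map fun r => (r.label, r.ainvs, r.p)
  | .k45298c1 => (kRowsOf KuriharaRecords.cert_X6_45298c1_p5).map fun r => (r.label, r.ainvs, r.p)
  | .k46774a1 => (kRowsOf KuriharaRecords.cert_X6_46774a1_p5).map fun r => (r.label, r.ainvs, r.p)
  | .k12927e1 => (kRowsOf KuriharaRecords.cert_X6_12927e1_p7).map fun r => (r.label, r.ainvs, r.p)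
  | .k27466a1 => (kRowsOf KuriharaRecords.cert_X6_27466a1_p7).map fun r => (r.label, r.ainvs, r.p)
  | .k44115c1 => (kRowsOf KuriharaRecords.cert_X6_44115c1_p7).map fun r => (r.label, r.ainvs, r.p)

/-- One coverage entry: the record's label and prime, its CANONICAL road of record, the declaration of record as a resolved
name (a data theorem for data roads, the per-pair `BSDp` theorem otherwise), the data pointer `(source, row index)` for data
roads, and the SECONDARY per-pair roads found for the same pair. [folklore] -/
structure Cover where
  /-- Cremona label (as in `Record.label`). -/
  label : String
  /-- the prime. -/
  p : ℕ
  /-- canonical road of record. -/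
  road : Road
  /-- declaration of record (name resolved at elaboration). -/
  decl : Lean.Name
  /-- data pointer for data roads: source list and row index. -/
  src : Option (Src × ℕ)
  /-- secondary roads: (road, declaration). -/
  also : List (Road × Lean.Name)

/-- Road discipline: at `p = 3` the canonical road is a `3`-descent row when `ord₃ #Ш_an = 2` and the second-descent theorem
otherwise (`ord₃ #Ш_an = 4`); at `p ≥ 5` one of the five `p ≥ 5` roads. [folklore] -/
def Cover.roadOK (r : Record) (c : Cover) : Bool :=
  if r.p = 3 then (if r.ordpSha = 2 then c.road.isDesc3 else decide (c.road = .secondDescent)) else c.road.atFive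

/-- Data discipline: a `3`-descent road points at a `3`-descent row with the record's `(label, ainvs, #Ш_an)` (exact row iff
exact road); the Kurihara-row road points at a Kurihara row with the record's `(label, ainvs, p)`; theorem roads carry no pointer. [folklore] -/
def Cover.dataOK (r : Record) (c : Cover) : Bool :=
  match c.src with
  | some (s, i) =>
    (c.road.isDesc3 && s.isDesc3 && decide (decide (c.road = .desc3Exact) = s.isExact) &&
      decide (s.rows[i]? = some (r.label, r.ainvs, r.shaAn))) ||
    (decide (c.road = .kuriharaCert) && !s.isDesc3 && decide (s.rows[i]? = some (r.label, r.ainvs, r.p)))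
  | none => !c.road.isDesc3 && decide (c.road ≠ .kuriharaCert)

/-- The per-entry recheck: same label and prime as the record, road discipline, data discipline. [folklore] -/
def Cover.check (r : Record) (c : Cover) : Bool :=
  decide (c.label = r.label) && decide (c.p = r.p) && c.roadOK r && c.dataOK r

/-- `covers rs cs`: the entries `cs` recheck against the records `rs` position by position (same length). [folklore] -/
def covers : List Record → List Cover → Bool
  | [], [] => true
  | r :: rs, c :: cs => c.check r && covers rs cs
  | _, _ => false

/-- `covers` is compatible with concatenation. [folklore] -/
theorem covers_append {rs rs' : List Record} {cs cs' : List Cover} (h : covers rs cs = true)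
    (h' : covers rs' cs' = true) : covers (rs ++ rs') (cs ++ cs') = true := by
  induction rs generalizing cs with
  | nil =>
    cases cs with
    | nil => simpa using h'
    | cons c cs => simp [covers] at h
  | cons r rs ih =>
    cases cs with
    | nil => simp [covers] at h
    | cons c cs =>
      simp only [covers, Bool.and_eq_true] at h
      simp only [List.cons_append, covers, Bool.and_eq_true]
      exact ⟨h.1, ih h.2⟩

/-- Unpacking `covers`: every record has an entry that rechecks against it. [folklore] -/
theorem exists_check_of_covers {rs : List Record} {cs : List Cover} (h : covers rs cs = true) :
    ∀ r ∈ rs, ∃ c ∈ cs, c.check r = true := by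
  induction rs generalizing cs with
  | nil => intro r hr; simp at hr
  | cons r₀ rs ih =>
    cases cs with
    | nil => simp [covers] at h
    | cons c cs =>
      simp only [covers, Bool.and_eq_true] at h
      intro r hr
      rcases List.mem_cons.mp hr with rfl | hr
      · exact ⟨c, List.mem_cons_self, h.1⟩
      · obtain ⟨c', hc', hcc⟩ := ih h.2 r hr
        exact ⟨c', List.mem_cons_of_mem _ hc', hcc⟩

/-- Unpacking `covers`: the entries list the records' labels in order. [folklore] -/
theorem labels_of_covers {rs : List Record} {cs : List Cover} (h : covers rs cs = true) :
    cs.map Cover.label = rs.map Record.label := by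
  induction rs generalizing cs with
  | nil =>
    cases cs with
    | nil => rfl
    | cons c cs => simp [covers] at h
  | cons r rs ih =>
    cases cs with
    | nil => simp [covers] at h
    | cons c cs =>
      simp only [covers, Cover.check, Bool.and_eq_true, decide_eq_true_eq] at h
      simp only [List.map_cons, h.1.1.1, ih h.2]

namespace Cover

variable {r : Record} {c : Cover}

/-- An entry that rechecks has the record's label and prime. [folklore] -/
theorem label_eq_of_check (h : c.check r = true) : c.label = r.label ∧ c.p = r.p := by
  simp only [Cover.check, Bool.and_eq_true, decide_eq_true_eq] at h
  exact ⟨h.1.1.1, h.1.1.2⟩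

/-- At `p = 3`, `ord₃ #Ш_an = 2`: the canonical road is a `3`-descent row. [folklore] -/
theorem isDesc3_of_check (h : c.check r = true) (hp : r.p = 3) (h2 : r.ordpSha = 2) : c.road.isDesc3 = true := by
  simp only [Cover.check, Bool.and_eq_true, Cover.roadOK, hp, h2, if_true] at h
  exact h.1.2

/-- At `p = 3`, `ord₃ #Ш_an ≠ 2`: the canonical road is the second-descent theorem. [folklore] -/
theorem secondDescent_of_check (h : c.check r = true) (hp : r.p = 3) (h2 : r.ordpSha ≠ 2) : c.road = .secondDescent := by
  simp only [Cover.check, Bool.and_eq_true, Cover.roadOK, hp, h2, if_true, if_false, decide_eq_true_eq] at h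
  exact h.1.2

/-- At `p ≠ 3`: the canonical road is one of the five `p ≥ 5` roads. [folklore] -/
theorem atFive_of_check (h : c.check r = true) (hp : r.p ≠ 3) : c.road.atFive = true := by
  simp only [Cover.check, Bool.and_eq_true, Cover.roadOK, hp, if_false] at h
  exact h.1.2

/-- A `3`-descent road points at a tree `3`-descent row carrying the record's label, a-invariants and `#Ш_an`
(an exact row iff the road is `desc3Exact`). [folklore] -/
theorem desc3Row_of_check (h : c.check r = true) (hd : c.road.isDesc3 = true) :
    ∃ s : Src, ∃ i : ℕ, c.src = some (s, i) ∧ s.isDesc3 = true ∧ (decide (c.road = .desc3Exact) = s.isExact) ∧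
      s.rows[i]? = some (r.label, r.ainvs, r.shaAn) := by
  simp only [Cover.check, Bool.and_eq_true] at h
  have hd' := h.2
  rcases hsrc : c.src with _ | ⟨s, i⟩
  · simp [Cover.dataOK, hsrc, hd] at hd'
  · simp only [Cover.dataOK, hsrc, Bool.or_eq_true, Bool.and_eq_true, decide_eq_true_eq,
      Bool.not_eq_true'] at hd'
    rcases hd' with ⟨⟨⟨_, hs⟩, he⟩, hrow⟩ | ⟨⟨hk, _⟩, _⟩
    · exact ⟨s, i, rfl, hs, he, hrow⟩
    · exfalso; rw [hk] at hd; simp [Road.isDesc3] at hd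

/-- The Kurihara-row road points at a tree Kurihara row carrying the record's label, a-invariants and prime. [folklore] -/
theorem kuriharaRow_of_check (h : c.check r = true) (hk : c.road = .kuriharaCert) :
    ∃ s : Src, ∃ i : ℕ, c.src = some (s, i) ∧ s.isDesc3 = false ∧ s.rows[i]? = some (r.label, r.ainvs, r.p) := by
  simp only [Cover.check, Bool.and_eq_true] at h
  have hd' := h.2
  rcases hsrc : c.src with _ | ⟨s, i⟩
  · simp [Cover.dataOK, hsrc, hk] at hd'
  · simp only [Cover.dataOK, hsrc, Bool.or_eq_true, Bool.and_eq_true, decide_eq_true_eq,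
      Bool.not_eq_true'] at hd'
    rcases hd' with ⟨⟨⟨hd3, _⟩, _⟩, _⟩ | ⟨⟨_, hs⟩, hrow⟩
    · exfalso; rw [hk] at hd3; simp [Road.isDesc3] at hd3
    · exact ⟨s, i, rfl, hs, hrow⟩

end Cover

/-- A pointed `3`-descent key is a member of its source list. [folklore] -/
theorem Src.mem_rows_of_getElem? {s : Src} {i : ℕ} {k : Key} (h : s.rows[i]? = some k) : k ∈ s.rows :=
  List.mem_of_getElem? h

end Summit.BirchSwinnertonDyer.Rank1Residual.X6.PrintCert

end
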